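import Literature.MathematicalPhysics.QuantumFieldTheory.Balaban1983to89.B16Eq190Resummation
import Literature.Probability.LatticeModels.PolymerPressureAnalytic

/-!
# `Balaban1983to89.B16RatioResummationDefs` — DEFINITIONS for the RATIO form of the component resummation (1.90)–(1.91) of
# [Balaban1989LargeFieldII] (pp. 387–388) with [KoteckyPreiss1986] (5), typed for SUBSET polymers: items, term weights, hole-anchored
# activities, hole chains, index sets

Definitions file of a four-file group (`…Defs`: this file; `…Items`: item∕weight lemmas and the Kotecký–Preiss ratio step; `B16RatioResummation`:
the identity «decorated gas ∕ vacuum gas = hard-core gas of hole-anchored polymers»; `…Props`: locality, generation of hole chains, continuity,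
reality).  SETTING: polymers are finite subsets `Finset α` of a finite carrier with the equal-or-meet hard core `LatticeModels.polyInc`; a finite
CATALOGUE `Λ` of non-empty VACUUM polymers with activities `v`; HOLE polymers (selected by a predicate `adm`) with activities `h`; MARKED POINTS
`Q ⊆ α` that hole polymers must cover.  The ITEMS of a term of the decorated expansion are hole polymers (the operation domains `X_j` of (1.90))
and Kotecký–Preiss CLUSTERS of vacuum polymers (the localization domains `Y ∈ 𝐃`); two items are LINKED iff their footprints meet — the sibling
`B16Eq190Resummation`'s `olink` for the cube adjacency `=` and no fixed region, so that its Parts A∕B apply BY NAME.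

CONTENT (data and predicates only; no theorem): `HItem`, `CItem`, `Item`, `loc`, `link`; the Mayer factor `mayerU v C = e^{−Φ^T(C)} − 1`; the
support conditions `TermOk` and the TERM WEIGHT `termW = Π h(X) · Π u_C` on its support ((1.91)'s summand); the local covering clause `LocCov`
and the covered weight `termWCov`; THE HOLE-ANCHORED ACTIVITY `holeAct` = the sibling's `F` (1.91) of the covered weight; HOLE CHAINS
`IsHoleChain` (footprints of connected item families with a hole item: the polymers of the hole-anchored gas); `vacCompat Λ S` (vacuum polymers
compatible with a hole family), `attached Λ S` (clusters of `Λ` attached to it); the covering predicates `HCov`, `GCov` and the index sets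
`IsHoleFamily` (compatible admissible hole families covering `Q`) ∕ `IsChainFamily` (compatible families of hole chains covering `Q`).

NOT CLAIMED: anything analytic (activities abstract); the paper's d = 4 cube geometry (DIVERGENCE: arbitrary finite subsets, equal-or-meet hard
core).  The COVERING CLAUSE by marked points (`LocCov`, `HCov`, `GCov`, and inside `IsHoleFamily` ∕ `IsChainFamily`) is NOT in [Balaban1989LargeFieldII]
(1.90)–(1.91): it is the `T³` paper's «the polymer `Y_j` contains the located large-field bonds `c₁,…,c_n` of the history» ([Balaban1985UV3] (43)
p.266, `Y_j ⊇ {B_k(c₁),…,B_k(c_n)}`), which the `T³` tower's histories impose; those predicates cite (43).  No `sorry`; no named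
fact (no closed `Prop`); `open Classical` supplies the decidability of the support conditions inside `if`.

References: [Balaban1989LargeFieldII] T. Bałaban, *Large field renormalization. II. Localization, exponentiation, and bounds for the
𝐑 operation*, Commun. Math. Phys. **122** (1989) 355–392, pp. 387–388 (1.90)–(1.91); [KoteckyPreiss1986] R. Kotecký, D. Preiss, *Cluster
expansion for abstract polymer models*, Commun. Math. Phys. **103** (1986) 491–498, (5) and Theorem p. 492; [Dimock2013BalabanII] J. Dimock,
*The renormalization group according to Balaban II. Large fields*, J. Math. Phys. **54** (2013) 092301, App. F (the same resummation for
scalar fields, template only); [Balaban1985UV3] T. Bałaban, *Ultraviolet stability of three-dimensional lattice pure gauge field theories*, Commun. Math. Phys.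
**102** (1985) 255–275, (43) p.266 (histories with located large-field bonds `c_i` contained in the polymer).
-/

namespace Literature.MathematicalPhysics.QuantumFieldTheory.Balaban1983to89.B16RatioResummation

open Classical
open Finset
open Literature.Probability.LatticeModels
open Literature.MathematicalPhysics.QuantumFieldTheory.Balaban1983to89.B16Eq190Resummation

noncomputable section

variable {α : Type*} [DecidableEq α]

/-! ## Items, footprints, links -/

/-- A HOLE item: a non-empty subset polymer (an operation domain `X_j` of (1.90)). [cite: Balaban1989LargeFieldII, (1.90) p.388] -/
abbrev HItem (α : Type*) : Type _ := {X : Finset α // X.Nonempty}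

/-- A CLUSTER item: a non-empty finite family of non-empty subset polymers (a localization domain `Y ∈ 𝐃` of (1.90), here a
Kotecký–Preiss cluster of vacuum polymers). [cite: Balaban1989LargeFieldII, (1.90) p.388] -/
abbrev CItem (α : Type*) : Type _ := {C : Finset (Finset α) // C.Nonempty ∧ ∀ γ ∈ C, γ.Nonempty}

/-- The items of a term: hole polymers and clusters. [cite: Balaban1989LargeFieldII, (1.91) p.388] -/
abbrev Item (α : Type*) : Type _ := HItem α ⊕ CItem α

/-- The footprint of an item: the hole polymer itself, or the support `⋃ C` of a cluster. [cite: Balaban1989LargeFieldII, (1.91) p.388] -/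
def loc : Item α → Finset α := Sum.elim (fun X => X.1) (fun C => C.1.biUnion id)

/-- Two items are LINKED iff their footprints meet (the sibling's `olink` for the cube adjacency `=` and no fixed region).
[cite: Balaban1989LargeFieldII, (1.90) p.388] -/
abbrev link : Item α → Item α → Prop := olink (fun a b : α => a = b) loc ∅

/-- The Mayer factor of a cluster: `u_C = e^{−Φ^T(C)} − 1`. [cite: KoteckyPreiss1986, (5)] -/
def mayerU (v : Finset α → ℂ) (C : Finset (Finset α)) : ℂ := Complex.exp (-truncatedWeight polyInc v C) - 1

/-- The SUPPORT CONDITIONS of a term `T` (its hole items `T.toLeft`, its cluster items `T.toRight`): every hole polymer admissible,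
the hole polymers pairwise compatible, every cluster a Kotecký–Preiss cluster of the catalogue `Λ` attached (incompatible) to some hole
polymer of the term. [cite: Balaban1989LargeFieldII, (1.91) p.388] -/
def TermOk (adm : Finset α → Prop) (Λ : Finset (Finset α)) (T : Finset (Item α)) : Prop :=
  (∀ X ∈ T.toLeft, adm X.1) ∧
  (∀ X ∈ T.toLeft, ∀ X' ∈ T.toLeft, X ≠ X' → ¬ polyInc X.1 X'.1) ∧
  (∀ C ∈ T.toRight, C.1 ⊆ Λ ∧ IsPolymerCluster polyInc C.1 ∧ ∃ X ∈ T.toLeft, ∃ γ ∈ C.1, polyInc γ X.1)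

/-- The TERM WEIGHT `W(T) = Π_{X} h(X) · Π_{C} (e^{−Φ^T(C)} − 1)` on its support. [cite: Balaban1989LargeFieldII, (1.91) p.388] -/
def termW (adm : Finset α → Prop) (Λ : Finset (Finset α)) (h v : Finset α → ℂ) (T : Finset (Item α)) : ℂ :=
  if TermOk adm Λ T then (∏ X ∈ T.toLeft, h X.1) * ∏ C ∈ T.toRight, mayerU v C.1 else 0

/-- The LOCAL COVERING clause of a term for the marked points `Q`: every marked point inside the footprint lies in a hole polymer of
the term.  This is the `T³` paper's clause «the polymer contains the located large-field bonds `c₁,…,c_n` of the history»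
([Balaban1985UV3] (43): `Y_j ⊇ {B_k(c₁),…,B_k(c_n)}`), NOT a clause of [Balaban1989LargeFieldII] (1.90)–(1.91). [cite: Balaban1985UV3, (43) p.266] -/
def LocCov (Q : Finset α) (T : Finset (Item α)) : Prop := ∀ b ∈ Q, b ∈ fp loc T → ∃ X ∈ T.toLeft, b ∈ X.1

/-- The covered term weight: the (1.91) term weight restricted by the local covering clause of [Balaban1985UV3] (43) (the clause is not in
[Balaban1989LargeFieldII]). [folklore] -/
def termWCov (adm : Finset α → Prop) (Λ : Finset (Finset α)) (Q : Finset α) (h v : Finset α → ℂ) (T : Finset (Item α)) : ℂ :=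
  if LocCov Q T then termW adm Λ h v T else 0

/-- **THE HOLE-ANCHORED ACTIVITY** `ζ(Y)`: the sum of the covered term weights over the connected item families with footprint `Y`
(the sibling's `F`, (1.91)). [cite: Balaban1989LargeFieldII, (1.91) p.388] -/
def holeAct [Fintype α] (adm : Finset α → Prop) (Λ : Finset (Finset α)) (Q : Finset α) (h v : Finset α → ℂ) (Y : Finset α) : ℂ :=
  F (fun a b : α => a = b) loc ∅ (termWCov adm Λ Q h v) Y

/-- **HOLE CHAINS**: the footprints `Y` of connected item families containing a hole item, with admissible hole items and cluster items that
are Kotecký–Preiss clusters of the catalogue — the polymers of the hole-anchored gas ((1.90)'s `X′_p`).  This is the WEAKENING of the support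
conditions `TermOk` to «admissible holes + catalogue clusters» (pairwise hole compatibility and the attachment clause are dropped): it
suffices because every `TermOk` connected family with a hole item witnesses a hole chain, while a footprint that is NOT a hole chain carries
zero activity (`holeAct_eq_zero_of_not_isHoleChain` in `B16RatioResummation`). [cite: Balaban1989LargeFieldII, (1.90) p.388] -/
def IsHoleChain [Fintype α] (adm : Finset α → Prop) (Λ : Finset (Finset α)) (Y : Finset α) : Prop :=
  ∃ T : Finset (Item α), IsLConn link T ∧ fp loc T = Y ∧ T.toLeft.Nonempty ∧ (∀ X ∈ T.toLeft, adm X.1) ∧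
    ∀ C ∈ T.toRight, C.1 ⊆ Λ ∧ IsPolymerCluster polyInc C.1

/-! ## The vacuum side: compatible vacuum polymers and attached clusters -/

section Vacuum

variable (Λ : Finset (Finset α))

/-- The vacuum polymers of the catalogue COMPATIBLE with (every member of) the hole family `S`. [cite: KoteckyPreiss1986, (5)] -/
def vacCompat (S : Finset (Finset α)) : Finset (Finset α) := Λ.filter fun γ => ∀ X ∈ S, ¬ polyInc γ X

/-- The clusters of the catalogue ATTACHED to the hole family `S`: Kotecký–Preiss clusters of `Λ` with a member incompatible with a
member of `S`. [cite: KoteckyPreiss1986, (5)] -/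
def attached (S : Finset (Finset α)) : Finset (Finset (Finset α)) :=
  Λ.powerset.filter fun C => (∃ γ ∈ C, ∃ X ∈ S, polyInc γ X) ∧ IsPolymerCluster polyInc C

end Vacuum

/-! ## Covering predicates and the two index sets -/

/-- The hole items of a family COVER the marked points `Q`: every located large-field bond of the history lies in a hole polymer — the `T³`
paper's «`Y_j ⊇ {B_k(c₁),…,B_k(c_n)}`» ([Balaban1985UV3] (43)), not a clause of [Balaban1989LargeFieldII]. [cite: Balaban1985UV3, (43) p.266] -/
def HCov (Q : Finset α) (L : Finset (HItem α)) : Prop := ∀ b ∈ Q, ∃ X ∈ L, b ∈ X.1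

/-- A family of footprints COVERS the marked points `Q` (every located large-field bond lies in some footprint; [Balaban1985UV3] (43)'s
clause at the level of footprints; not a clause of [Balaban1989LargeFieldII]). [cite: Balaban1985UV3, (43) p.266] -/
def GCov (Q : Finset α) (𝒴 : Finset (Finset α)) : Prop := ∀ b ∈ Q, ∃ Y ∈ 𝒴, b ∈ Y

/-- The DECORATED index set: compatible families (the (1.90)-shaped part) of admissible hole polymers covering the marked points `Q` (the
covering clause is [Balaban1985UV3] (43)'s «the polymers contain the located large-field bonds», not in [Balaban1989LargeFieldII]).  NOTE for
consumers: if `adm ∅` held, `∅` could be a member; the identity `decorated_gas_eq_vacuum_mul_holeAnchored` therefore assumes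
`adm X → X.Nonempty`. [cite: Balaban1985UV3, (43) p.266] -/
def IsHoleFamily (adm : Finset α → Prop) (Q : Finset α) (S : Finset (Finset α)) : Prop :=
  IsCompatible polyInc S ∧ GCov Q S ∧ ∀ X ∈ S, adm X

section Index

variable [Fintype α]

/-- The HOLE-ANCHORED index set: compatible families (the (1.90)-shaped part) of hole chains covering the marked points `Q` (the covering
clause is [Balaban1985UV3] (43)'s, not in [Balaban1989LargeFieldII]). [cite: Balaban1985UV3, (43) p.266] -/
def IsChainFamily (adm : Finset α → Prop) (Λ : Finset (Finset α)) (Q : Finset α) (𝒴 : Finset (Finset α)) : Prop :=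
  IsCompatible polyInc 𝒴 ∧ GCov Q 𝒴 ∧ ∀ Y ∈ 𝒴, IsHoleChain adm Λ Y

end Index

end

end Literature.MathematicalPhysics.QuantumFieldTheory.Balaban1983to89.B16RatioResummation
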